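import Literature.AlgebraicGeometry.AbelianSchemes.PELTupleSpreadStageOfIsoBase   -- ★ (mine) GSPREAD-CORE head + iso-base ∕ localised ∕ pointwise readings; re-exports everything used below
import HarnessLib

/-!
# GSPREAD-CORE with the dual pair of the stage family as a HYPOTHESIS (road (S♭) under the weak duals letter)

★ `exists_stage_pelTuple_of_generic` takes the printed letter P-2′ `dualAbelianSchemeExists` (every abelian scheme has a dual pair).  The closer leaf
above the P-line carries only the WEAKER antecedent `DualPairOfAmpleRigidified` (duals of abelian schemes over affine Noetherian bases carrying a
rigidified line bundle with ample fibres and `K(L)` killed by an invertible `n`), from which the dual pair of the STAGE family is to be built by its own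
road (`L := L^Δ(λ)` spread, affine charts of the stage base, ★ `nonempty_dualPair_of_charts`).  This file re-cuts GSPREAD-CORE at exactly that seam: the
head `exists_stage_pelTuple_of_generic_of_stageDuals` takes, instead of P-2′, the hypothesis «every stage model `𝒜ₜ` of `A₁` (`A₁ ≅ 𝒜ₜ ×_{P_t} (P ⊗ Spec K)`
as group schemes) acquires a dual pair at some finer stage» — supplied trivially by P-2′ (§3) and, on the leaf's road, by the duals letter applied to the
spread of `L^Δ(λ₁)`.  The proof is the proof of ★ `exists_stage_pelTuple_of_generic` with step (2′) «restrict to the finer stage where the dual pair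
lives» inserted (★ `exists_isBaseChangeVia_baseChange_of_over_hom`); the second half is ★ `exists_stage_pelTuple_of_stage_polarization` verbatim.  §2: the
identified-generic-base, localised and pointwise readings (as in ★ `PELTupleSpreadStageOfIsoBase`) under the same hypothesis.

## What existed / was missing / was proved
* existed (★): everything named above.
* missing, proved here (sorry-free): `exists_stage_pelTuple_of_generic_of_stageDuals` (§1), `exists_stage_pelTuple_of_generic_of_iso_base_of_stageDuals`,
  `exists_stage_pelTuple_of_generic_of_iso_base_pointwise_of_stageDuals` (§2), `stageDuals_of_dualAbelianSchemeExists` (§3).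
-/

set_option autoImplicit false

noncomputable section

-- Mathlib's `Over`/pull-back API is stated across semireducible wrappers (as in the ★ `AbelianSchemes/*` files).
set_option backward.isDefEq.respectTransparency false

open CategoryTheory CategoryTheory.Limits AlgebraicGeometry MonoidalCategory
open Literature.AlgebraicGeometry.Limits Literature.AlgebraicGeometry.Limits.LocApprox
open Literature.AlgebraicGeometry.Limits.OverFac (facObjIso)
open Literature.AlgebraicGeometry.Motives (SchemeOver specOver)

namespace Literature.AlgebraicGeometry.AbelianSchemes

namespace AbelianSchemeOver

section Head

variable {A : Type} [CommRing A] [IsDomain A] [IsNoetherianRing A] (K : Type) [Field K] [CharZero K] [Algebra A K] [IsFractionRing A K]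
  {P : SchemeOver A} [QuasiCompact P.hom] [QuasiSeparated P.hom] [LocallyOfFinitePresentation P.hom] [IsSeparated P.hom]
  [∀ s : Idx (nonZeroDivisors A), IsLocallyNoetherian (P ⊗ (baseDiagram (nonZeroDivisors A)).obj s).left]
  [IsLocallyNoetherian (P ⊗ specOver A K).left] [IsReduced (P ⊗ specOver A K).left]

/-! ### §1 The head under the stage-duals hypothesis -/

/-- **GSPREAD-CORE UNDER THE STAGE-DUALS HYPOTHESIS.**  As ★ `exists_stage_pelTuple_of_generic` (a PEL tuple over `P ⊗_A K` is the base change of a PEL tuple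
over a stage, six clauses), with the letter P-2′ replaced by `hdual`: for every stage `t`, every abelian scheme `𝒜ₜ` over `P ⊗ D(t)` and every `G` exhibiting
`A₁` as the base change of `𝒜ₜ` along the cone leg (as group schemes), SOME restriction `𝒜ₜ ×_{P⊗D(t)} (P ⊗ D(s))` (`σ : s ⟶ t`) carries a dual pair.
[cite: MumfordFogartyKirwan1994, Ch. 7 §2 Definition 7.2 (p. 129), Definition 7.3 (p. 130) and §3 Proposition 7.3 steps (III)–(IV) (pp. 133–134)]
[cite: EGAIV3, Thm. 8.8.2 and Thm. 8.10.5] [cite: GortzWedhorn2020, §(10.13) and Thm. 10.57 ∕ Cor. 10.64 (pp. 261–267)] [cite: Kottwitz1992, §5 (pp. 389–391)]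
[cite: MumfordAV1970, §13 Theorem (p. 125)] -/
theorem exists_stage_pelTuple_of_generic_of_stageDuals (hP : IsProper (pullback.snd P.hom (specOver A K).hom))
    {O : Type*} [CommRing O] {m : ℕ} (bs : Module.Basis (Fin m) ℤ O) {g N : ℕ} [NeZero N] (hN : IsUnit ((N : ℕ) : K))
    (A₁ : AbelianSchemeOver (P ⊗ specOver A K).left) (ρ₁ : RingAction O A₁) (D₁ : A₁.DualPair) (pol₁ : A₁.Polarization D₁)
    (φ₁ : A₁.LevelStructure g N) (hg : A₁.IsOfRelDim g)
    (hdual : ∀ (t : Idx (nonZeroDivisors A)) (𝒜ₜ : AbelianSchemeOver (P ⊗ (baseDiagram (nonZeroDivisors A)).obj t).left)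
      (G : A₁.X.left ⟶ 𝒜ₜ.X.left), A₁.IsBaseChangeVia 𝒜ₜ (P ◁ (baseCone (nonZeroDivisors A) K).π.app t).left G →
      ∃ (s : Idx (nonZeroDivisors A)) (σ : s ⟶ t), Nonempty (𝒜ₜ.baseChange (stageOver (nonZeroDivisors A) P σ).hom).DualPair) :
    ∃ (s : Idx (nonZeroDivisors A)) (𝒜 : AbelianSchemeOver (P ⊗ (baseDiagram (nonZeroDivisors A)).obj s).left) (ρ : RingAction O 𝒜)
      (D : 𝒜.DualPair) (pol : 𝒜.Polarization D) (φ : 𝒜.LevelStructure g N) (G : A₁.X.left ⟶ 𝒜.X.left) (Ĝ : D₁.hat.X.left ⟶ D.hat.X.left),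
      𝒜.IsOfRelDim g ∧ Flat (pullback.snd P.hom ((baseDiagram (nonZeroDivisors A)).obj s).hom) ∧
      (φ₁.IsBaseChangeVia φ (P ◁ (baseCone (nonZeroDivisors A) K).π.app s).left G ∧
        D₁.hat.IsBaseChangeVia D.hat (P ◁ (baseCone (nonZeroDivisors A) K).π.app s).left Ĝ ∧
        (∃ (wG : A₁.X.hom ≫ (P ◁ (baseCone (nonZeroDivisors A) K).π.app s).left = G ≫ 𝒜.X.hom)
            (wĜ : D₁.hat.X.hom ≫ (P ◁ (baseCone (nonZeroDivisors A) K).π.app s).left = Ĝ ≫ D.hat.X.hom),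
          Nonempty ((Scheme.Modules.pullback
            (pullback.map A₁.X.hom D₁.hat.X.hom 𝒜.X.hom D.hat.X.hom G Ĝ (P ◁ (baseCone (nonZeroDivisors A) K).π.app s).left wG wĜ)).obj
              D.P ≅ D₁.P)) ∧
        pol₁.lam.left ≫ Ĝ = G ≫ pol.lam.left ∧ ∀ a : O, (ρ₁.i a).left ≫ G = G ≫ (ρ.i a).left)   := by
  classical
  -- (0) `2 ∈ A[1∕t]^×` below some stage `m₂`
  have h2K : IsUnit ((2 : ℕ) : K) := by rw [Nat.cast_ofNat]; exact isUnit_iff_ne_zero.mpr two_ne_zero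
  obtain ⟨m₂, hm₂⟩ := exists_idx_forall_isUnit_algebraMap_loc (S := nonZeroDivisors A) 2 h2K
  -- (1) spread the abelian scheme ★ (s1-A♭)
  obtain ⟨t₀, 𝒜₀, G₀, hbc₀, hg₀, hfl₀⟩ := exists_stage_of_generic_of_isOfRelDim_of_isProper_generic hP A₁ hg
  -- (2) restrict to `t₁ ≤ t₀, m₂`
  obtain ⟨t₁, σ₀, ⟨τ₂⟩⟩ : ∃ (t : Idx (nonZeroDivisors A)) (_ : t ⟶ t₀), Nonempty (t ⟶ m₂) :=
    ⟨_, IsCofiltered.minToLeft t₀ m₂, ⟨IsCofiltered.minToRight t₀ m₂⟩⟩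
  obtain ⟨G₁, hbc₁, -⟩ := exists_isBaseChangeVia_baseChange_of_over_hom (relLeg (nonZeroDivisors A) K P σ₀) 𝒜₀ hbc₀
  -- (2′) the DUAL PAIR of the stage family, at a finer stage `t` (hypothesis `hdual`)
  obtain ⟨t, σ₁', ⟨D'⟩⟩ := hdual t₁ (𝒜₀.baseChange (stageOver (nonZeroDivisors A) P σ₀).hom) G₁ hbc₁
  obtain ⟨Gt, hbct, -⟩ := exists_isBaseChangeVia_baseChange_of_over_hom (relLeg (nonZeroDivisors A) K P σ₁')
    (𝒜₀.baseChange (stageOver (nonZeroDivisors A) P σ₀).hom) hbc₁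
  have h2t : IsUnit (2 : loc (nonZeroDivisors A) t) := by
    have h := hm₂ t (leOfHom (σ₁' ≫ τ₂)); rwa [map_natCast, Nat.cast_ofNat] at h
  haveI hflt : Flat (pullback.snd P.hom ((baseDiagram (nonZeroDivisors A)).obj t).hom) :=
    flat_snd_baseDiagram_of_hom σ₁' (flat_snd_baseDiagram_of_hom σ₀ hfl₀)
  -- the stage family at `t` (generalised) with its normalised dual pair
  obtain ⟨𝒜ₜ, Gt, Dₜ, hbct', hgt, hDₜ⟩ : ∃ (𝒜ₜ : AbelianSchemeOver (P ⊗ (baseDiagram (nonZeroDivisors A)).obj t).left)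
      (Gt : A₁.X.left ⟶ 𝒜ₜ.X.left) (Dₜ : 𝒜ₜ.DualPair), A₁.IsBaseChangeVia 𝒜ₜ (genOver (nonZeroDivisors A) K P t).hom Gt ∧ 𝒜ₜ.IsOfRelDim g ∧
      Nonempty ((Scheme.Modules.pullback (DualPair.unitHatSlice Dₜ)).obj Dₜ.P ≅ SheafOfModules.unit _) :=
    ⟨(𝒜₀.baseChange (stageOver (nonZeroDivisors A) P σ₀).hom).baseChange (stageOver (nonZeroDivisors A) P σ₁').hom, Gt, D'.normalize, hbct,
      (hg₀.baseChange _).baseChange _, DualPair.nonempty_unitHatSlice_iso_normalize _⟩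
  clear hbct hbc₁
  -- (3) transport the E′-structures to `𝒜ₜ ×_{P_t} (P ⊗ Spec K)`: an isomorphism of tuples
  haveI : IsLocallyNoetherian (genOver (nonZeroDivisors A) K P t).left := ‹IsLocallyNoetherian (P ⊗ specOver A K).left›
  haveI : IsReduced (genOver (nonZeroDivisors A) K P t).left := ‹IsReduced (P ⊗ specOver A K).left›
  obtain ⟨e, he, ρg, φg, polg, -, hR₀⟩ := exists_transport_baseChange_tupleRel_id_of_isBaseChangeVia 𝒜ₜ Dₜ
    (genOver (nonZeroDivisors A) K P t).hom ρ₁ D₁ pol₁ φ₁ hbct' hDₜ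
  -- (4) ★ (s2-λ): spread `λ` (one stage `σ₁`) to a polarization (one more stage `ρ'`)
  obtain ⟨s₁, σ₁, lam₁, _, hfac₁, s, ρ', polS, hpolS⟩ :=
    exists_stage_polarization_of_generic_polarization_of_isUnit_two' K 𝒜ₜ Dₜ polg h2t hDₜ
  -- MOVE 1 along `σ₁`
  obtain ⟨ρg₁, φg₁, hR₁⟩ := exists_ringAction_levelStructure_tupleRel_id_comp_facObjIso_inv (relLeg (nonZeroDivisors A) K P σ₁) 𝒜ₜ Dₜ
    (fun a => ρ₁.i a) D₁ pol₁.lam φ₁ polg.lam φg ρg hR₀ ((Over.pullback (relLeg (nonZeroDivisors A) K P σ₁).left).map lam₁) hfac₁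
  clear hR₀
  -- MOVE 2 along `ρ'`
  have hlam₂ : (Over.pullback (relLeg (nonZeroDivisors A) K P ρ').left).map polS.lam ≫
      (facObjIso (relLeg (nonZeroDivisors A) K P ρ') (Dₜ.baseChange (stageOver (nonZeroDivisors A) P σ₁).hom).hat.X).hom =
      (facObjIso (relLeg (nonZeroDivisors A) K P ρ') (𝒜ₜ.baseChange (stageOver (nonZeroDivisors A) P σ₁).hom).X).hom ≫
        (Over.pullback (relLeg (nonZeroDivisors A) K P σ₁).left).map lam₁ := by
    rw [hpolS]
    exact facObjIso_hom_naturality (relLeg (nonZeroDivisors A) K P ρ') (𝒜ₜ.baseChange (stageOver (nonZeroDivisors A) P σ₁).hom)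
      (ℬ := (Dₜ.baseChange (stageOver (nonZeroDivisors A) P σ₁).hom).hat) lam₁
  obtain ⟨ρg₂, φg₂, hR₂⟩ := exists_ringAction_levelStructure_tupleRel_id_comp_facObjIso_inv (relLeg (nonZeroDivisors A) K P ρ')
    (𝒜ₜ.baseChange (stageOver (nonZeroDivisors A) P σ₁).hom) (Dₜ.baseChange (stageOver (nonZeroDivisors A) P σ₁).hom)
    (fun a => ρ₁.i a) D₁ pol₁.lam φ₁ _ φg₁ ρg₁ hR₁ ((Over.pullback (relLeg (nonZeroDivisors A) K P ρ').left).map polS.lam) hlam₂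
  clear hR₁ hlam₂
  -- (5)–(7): second half, at the stage `s`
  haveI : Flat (pullback.snd P.hom ((baseDiagram (nonZeroDivisors A)).obj s).hom) :=
    flat_snd_baseDiagram_of_hom ρ' (flat_snd_baseDiagram_of_hom σ₁ hflt)
  exact exists_stage_pelTuple_of_stage_polarization K bs hN
    ((𝒜ₜ.baseChange (stageOver (nonZeroDivisors A) P σ₁).hom).baseChange (stageOver (nonZeroDivisors A) P ρ').hom)
    ((hgt.baseChange _).baseChange _) _ polS ρg₂ φg₂ A₁ ρ₁ D₁ pol₁ φ₁ hR₂


/-! ### §2 The identified-generic-base, localised and pointwise readings under the stage-duals hypothesis -/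

/-- **… OVER AN IDENTIFIED GENERIC BASE `e : Z ≅ P ⊗_A K`** (as ★ `exists_stage_pelTuple_of_generic_of_iso_base`; the stage-duals hypothesis is stated for the
`Z`-tuple, along `e.hom ≫` cone leg, and moved to `A₁ ×_Z (P ⊗ Spec K)` by ★ `IsBaseChangeVia.trans` with the `X`-clause of ★ `exists_tupleRel_baseChange_inv_of_iso`).
[cite: MumfordFogartyKirwan1994, Ch. 7 §2 Definition 7.2 (p. 129)] [cite: EGAIV3, Thm. 8.8.2 and Thm. 8.10.5] [cite: Kottwitz1992, §5 (pp. 389–391)] -/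
theorem exists_stage_pelTuple_of_generic_of_iso_base_of_stageDuals (hP : IsProper (pullback.snd P.hom (specOver A K).hom))
    {O : Type*} [CommRing O] {m : ℕ} (bs : Module.Basis (Fin m) ℤ O) {g N : ℕ} [NeZero N] (hN : IsUnit ((N : ℕ) : K))
    {Z : Scheme.{0}} (e : Z ≅ (P ⊗ specOver A K).left)
    (A₁ : AbelianSchemeOver Z) (ρ₁ : RingAction O A₁) (D₁ : A₁.DualPair) (pol₁ : A₁.Polarization D₁)
    (φ₁ : A₁.LevelStructure g N) (hg : A₁.IsOfRelDim g)
    (hdual : ∀ (t : Idx (nonZeroDivisors A)) (𝒜ₜ : AbelianSchemeOver (P ⊗ (baseDiagram (nonZeroDivisors A)).obj t).left)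
      (G : A₁.X.left ⟶ 𝒜ₜ.X.left), A₁.IsBaseChangeVia 𝒜ₜ (e.hom ≫ (P ◁ (baseCone (nonZeroDivisors A) K).π.app t).left) G →
      ∃ (s : Idx (nonZeroDivisors A)) (σ : s ⟶ t), Nonempty (𝒜ₜ.baseChange (stageOver (nonZeroDivisors A) P σ).hom).DualPair) :
    ∃ (s : Idx (nonZeroDivisors A)) (𝒜 : AbelianSchemeOver (P ⊗ (baseDiagram (nonZeroDivisors A)).obj s).left) (ρ : RingAction O 𝒜)
      (D : 𝒜.DualPair) (pol : 𝒜.Polarization D) (φ : 𝒜.LevelStructure g N) (G : A₁.X.left ⟶ 𝒜.X.left) (Ĝ : D₁.hat.X.left ⟶ D.hat.X.left),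
      𝒜.IsOfRelDim g ∧ Flat (pullback.snd P.hom ((baseDiagram (nonZeroDivisors A)).obj s).hom) ∧
      (φ₁.IsBaseChangeVia φ (e.hom ≫ (P ◁ (baseCone (nonZeroDivisors A) K).π.app s).left) G ∧
        D₁.hat.IsBaseChangeVia D.hat (e.hom ≫ (P ◁ (baseCone (nonZeroDivisors A) K).π.app s).left) Ĝ ∧
        (∃ (wG : A₁.X.hom ≫ e.hom ≫ (P ◁ (baseCone (nonZeroDivisors A) K).π.app s).left = G ≫ 𝒜.X.hom)
            (wĜ : D₁.hat.X.hom ≫ e.hom ≫ (P ◁ (baseCone (nonZeroDivisors A) K).π.app s).left = Ĝ ≫ D.hat.X.hom),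
          Nonempty ((Scheme.Modules.pullback
            (pullback.map A₁.X.hom D₁.hat.X.hom 𝒜.X.hom D.hat.X.hom G Ĝ (e.hom ≫ (P ◁ (baseCone (nonZeroDivisors A) K).π.app s).left)
              wG wĜ)).obj D.P ≅ D₁.P)) ∧
        pol₁.lam.left ≫ Ĝ = G ≫ pol.lam.left ∧ ∀ a : O, (ρ₁.i a).left ≫ G = G ≫ (ρ.i a).left) := by
  obtain ⟨m₁, mh₁, he⟩ := exists_tupleRel_baseChange_inv_of_iso e A₁ ρ₁ D₁ pol₁ φ₁
  have hdual' : ∀ (t : Idx (nonZeroDivisors A)) (𝒜ₜ : AbelianSchemeOver (P ⊗ (baseDiagram (nonZeroDivisors A)).obj t).left)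
      (G : (A₁.baseChange e.inv).X.left ⟶ 𝒜ₜ.X.left),
      (A₁.baseChange e.inv).IsBaseChangeVia 𝒜ₜ (P ◁ (baseCone (nonZeroDivisors A) K).π.app t).left G →
      ∃ (s : Idx (nonZeroDivisors A)) (σ : s ⟶ t), Nonempty (𝒜ₜ.baseChange (stageOver (nonZeroDivisors A) P σ).hom).DualPair :=
    fun t 𝒜ₜ G h => hdual t 𝒜ₜ (m₁ ≫ G) (he.1.1.trans h)
  obtain ⟨s, 𝒜, ρ, D, pol, φ, G, Ĝ, hg', hfl, hR⟩ := exists_stage_pelTuple_of_generic_of_stageDuals K hP bs hN (A₁.baseChange e.inv)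
    (ρ₁.baseChange e.inv) (D₁.baseChange e.inv) (pol₁.baseChange e.inv) (φ₁.baseChange e.inv) (hg.baseChange _) hdual'
  exact ⟨s, 𝒜, ρ, D, pol, φ, m₁ ≫ G, mh₁ ≫ Ĝ, hg', hfl, tupleRel_trans he hR⟩

/-- **… LOCALISED** (as ★ `exists_stage_pelTuple_of_generic_of_iso_base_localise`, under the stage-duals hypothesis).
[cite: EGAIV3, Thm. 8.8.2 and (8.8.2.5)] [cite: MumfordFogartyKirwan1994, Ch. 7 §2 Definition 7.2 (p. 129)] -/
theorem exists_stage_pelTuple_of_generic_of_iso_base_localise_of_stageDuals (hP : IsProper (pullback.snd P.hom (specOver A K).hom))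
    {O : Type*} [CommRing O] {m : ℕ} (bs : Module.Basis (Fin m) ℤ O) {g N : ℕ} [NeZero N]
    (hN : IsUnit ((N : ℕ) : K)) {Z : Scheme.{0}} (e : Z ≅ (P ⊗ specOver A K).left)
    (A₁ : AbelianSchemeOver Z) (ρ₁ : RingAction O A₁) (D₁ : A₁.DualPair) (pol₁ : A₁.Polarization D₁)
    (φ₁ : A₁.LevelStructure g N) (hg : A₁.IsOfRelDim g)
    (hdual : ∀ (t : Idx (nonZeroDivisors A)) (𝒜ₜ : AbelianSchemeOver (P ⊗ (baseDiagram (nonZeroDivisors A)).obj t).left)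
      (G : A₁.X.left ⟶ 𝒜ₜ.X.left), A₁.IsBaseChangeVia 𝒜ₜ (e.hom ≫ (P ◁ (baseCone (nonZeroDivisors A) K).π.app t).left) G →
      ∃ (s : Idx (nonZeroDivisors A)) (σ : s ⟶ t), Nonempty (𝒜ₜ.baseChange (stageOver (nonZeroDivisors A) P σ).hom).DualPair) :
    ∃ (s : Idx (nonZeroDivisors A)) (𝒜 : AbelianSchemeOver (P ⊗ (baseDiagram (nonZeroDivisors A)).obj s).left) (ρ : RingAction O 𝒜)
      (D : 𝒜.DualPair) (pol : 𝒜.Polarization D) (φ : 𝒜.LevelStructure g N),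
      𝒜.IsOfRelDim g ∧ Flat (pullback.snd P.hom ((baseDiagram (nonZeroDivisors A)).obj s).hom) ∧
      ∀ {T : Type} [CommRing T] [Algebra A T] (τ : specOver A T ⟶ (baseDiagram (nonZeroDivisors A)).obj s)
        (κ : specOver A K ⟶ specOver A T),
        ∃ (G : A₁.X.left ⟶ (𝒜.baseChange (P ◁ τ).left).X.left) (Ĝ : D₁.hat.X.left ⟶ (D.baseChange (P ◁ τ).left).hat.X.left),
          φ₁.IsBaseChangeVia (φ.baseChange (P ◁ τ).left) (e.hom ≫ (P ◁ κ).left) G ∧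
          D₁.hat.IsBaseChangeVia (D.baseChange (P ◁ τ).left).hat (e.hom ≫ (P ◁ κ).left) Ĝ ∧
          (∃ (wG : A₁.X.hom ≫ e.hom ≫ (P ◁ κ).left = G ≫ (𝒜.baseChange (P ◁ τ).left).X.hom)
              (wĜ : D₁.hat.X.hom ≫ e.hom ≫ (P ◁ κ).left = Ĝ ≫ (D.baseChange (P ◁ τ).left).hat.X.hom),
            Nonempty ((Scheme.Modules.pullback
              (pullback.map A₁.X.hom D₁.hat.X.hom (𝒜.baseChange (P ◁ τ).left).X.hom (D.baseChange (P ◁ τ).left).hat.X.hom G Ĝ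
                (e.hom ≫ (P ◁ κ).left) wG wĜ)).obj (D.baseChange (P ◁ τ).left).P ≅ D₁.P)) ∧
          pol₁.lam.left ≫ Ĝ = G ≫ (pol.baseChange (P ◁ τ).left).lam.left ∧
          ∀ a : O, (ρ₁.i a).left ≫ G = G ≫ (baseChangeHom (ρ.i a) (P ◁ τ).left).left := by
  obtain ⟨s, 𝒜, ρ, D, pol, φ, G, Ĝ, hg', hfl, hR⟩ :=
    exists_stage_pelTuple_of_generic_of_iso_base_of_stageDuals K hP bs hN e A₁ ρ₁ D₁ pol₁ φ₁ hg hdual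
  refine ⟨s, 𝒜, ρ, D, pol, φ, hg', hfl, fun {T} _ _ τ κ => ?_⟩
  have hbase : e.hom ≫ (P ◁ (baseCone (nonZeroDivisors A) K).π.app s).left = (e.hom ≫ (P ◁ κ).left) ≫ (P ◁ τ).left := by
    rw [Category.assoc, whiskerLeft_left_comp_whiskerLeft_left_eq_leg (nonZeroDivisors A) K P s T τ κ]
  obtain ⟨G', Ĝ', -, -, h⟩ := exists_tupleRel_stage_baseChange_of_tupleRel_comp_whiskerLeft (nonZeroDivisors A) P s T 𝒜 ρ D pol φ τ
    (e.hom ≫ (P ◁ κ).left) (tupleRel_congr_base hbase hR)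
  exact ⟨G', Ĝ', h⟩

/-- **… LOCALISED AND POINTWISE** — the `gen_iso` clauses of the spread under the stage-duals hypothesis (as ★
`exists_stage_pelTuple_of_generic_of_iso_base_pointwise`). [cite: MumfordFogartyKirwan1994, Ch. 7 §2 Definition 7.2 (p. 129)] [cite: EGAIV3, Thm. 8.8.2 and (8.8.2.5)] -/
theorem exists_stage_pelTuple_of_generic_of_iso_base_pointwise_of_stageDuals (hP : IsProper (pullback.snd P.hom (specOver A K).hom))
    {O : Type*} [CommRing O] {m : ℕ} (bs : Module.Basis (Fin m) ℤ O) {g N : ℕ} [NeZero N]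
    (hN : IsUnit ((N : ℕ) : K)) {Z : Scheme.{0}} (e : Z ≅ (P ⊗ specOver A K).left)
    (A₁ : AbelianSchemeOver Z) (ρ₁ : RingAction O A₁) (D₁ : A₁.DualPair) (pol₁ : A₁.Polarization D₁)
    (φ₁ : A₁.LevelStructure g N) (hg : A₁.IsOfRelDim g)
    (hdual : ∀ (t : Idx (nonZeroDivisors A)) (𝒜ₜ : AbelianSchemeOver (P ⊗ (baseDiagram (nonZeroDivisors A)).obj t).left)
      (G : A₁.X.left ⟶ 𝒜ₜ.X.left), A₁.IsBaseChangeVia 𝒜ₜ (e.hom ≫ (P ◁ (baseCone (nonZeroDivisors A) K).π.app t).left) G →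
      ∃ (s : Idx (nonZeroDivisors A)) (σ : s ⟶ t), Nonempty (𝒜ₜ.baseChange (stageOver (nonZeroDivisors A) P σ).hom).DualPair) :
    ∃ (s : Idx (nonZeroDivisors A)) (𝒜 : AbelianSchemeOver (P ⊗ (baseDiagram (nonZeroDivisors A)).obj s).left) (ρ : RingAction O 𝒜)
      (D : 𝒜.DualPair) (pol : 𝒜.Polarization D) (φ : 𝒜.LevelStructure g N),
      𝒜.IsOfRelDim g ∧ Flat (pullback.snd P.hom ((baseDiagram (nonZeroDivisors A)).obj s).hom) ∧
      ∀ {T : Type} [CommRing T] [Algebra A T] (τ : specOver A T ⟶ (baseDiagram (nonZeroDivisors A)).obj s)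
        (κ : specOver A K ⟶ specOver A T) {T' : Scheme.{0}} (t : T' ⟶ Z),
        ∃ (H : ((((𝒜.baseChange (P ◁ τ).left).baseChange (e.hom ≫ (P ◁ κ).left)).baseChange t)).X.left ⟶ (A₁.baseChange t).X.left)
          (Ĥ : (((D.baseChange (P ◁ τ).left).baseChange (e.hom ≫ (P ◁ κ).left)).baseChange t).hat.X.left ⟶ (D₁.baseChange t).hat.X.left),
          (((φ.baseChange (P ◁ τ).left).baseChange (e.hom ≫ (P ◁ κ).left)).baseChange t).IsBaseChangeVia (φ₁.baseChange t) (𝟙 T') H ∧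
          (((D.baseChange (P ◁ τ).left).baseChange (e.hom ≫ (P ◁ κ).left)).baseChange t).hat.IsBaseChangeVia (D₁.baseChange t).hat (𝟙 T') Ĥ ∧
          (∃ (wG : (((𝒜.baseChange (P ◁ τ).left).baseChange (e.hom ≫ (P ◁ κ).left)).baseChange t).X.hom ≫ 𝟙 T' =
                H ≫ (A₁.baseChange t).X.hom)
              (wĜ : (((D.baseChange (P ◁ τ).left).baseChange (e.hom ≫ (P ◁ κ).left)).baseChange t).hat.X.hom ≫ 𝟙 T' =
                Ĥ ≫ (D₁.baseChange t).hat.X.hom),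
            Nonempty ((Scheme.Modules.pullback
              (pullback.map (((𝒜.baseChange (P ◁ τ).left).baseChange (e.hom ≫ (P ◁ κ).left)).baseChange t).X.hom
                (((D.baseChange (P ◁ τ).left).baseChange (e.hom ≫ (P ◁ κ).left)).baseChange t).hat.X.hom (A₁.baseChange t).X.hom
                (D₁.baseChange t).hat.X.hom H Ĥ (𝟙 T') wG wĜ)).obj (D₁.baseChange t).P ≅
              (((D.baseChange (P ◁ τ).left).baseChange (e.hom ≫ (P ◁ κ).left)).baseChange t).P)) ∧
          (((pol.baseChange (P ◁ τ).left).baseChange (e.hom ≫ (P ◁ κ).left)).baseChange t).lam.left ≫ Ĥ = H ≫ (pol₁.baseChange t).lam.left ∧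
          ∀ a : O, (baseChangeHom (baseChangeHom ((ρ.baseChange (P ◁ τ).left).i a) (e.hom ≫ (P ◁ κ).left)) t).left ≫ H =
            H ≫ (baseChangeHom (ρ₁.i a) t).left := by
  obtain ⟨s, 𝒜, ρ, D, pol, φ, hg', hfl, hloc⟩ :=
    exists_stage_pelTuple_of_generic_of_iso_base_localise_of_stageDuals K hP bs hN e A₁ ρ₁ D₁ pol₁ φ₁ hg hdual
  refine ⟨s, 𝒜, ρ, D, pol, φ, hg', hfl, fun {T} _ _ τ κ {T'} t => ?_⟩
  obtain ⟨G, Ĝ, h⟩ := hloc τ κ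
  exact exists_tupleRel_id_baseChange_of_tupleRel ρ₁ D₁ pol₁ φ₁ (𝒜.baseChange (P ◁ τ).left) (ρ.baseChange (P ◁ τ).left)
    (D.baseChange (P ◁ τ).left) (pol.baseChange (P ◁ τ).left) (φ.baseChange (P ◁ τ).left) h t

/-! ### §3 The printed letter P-2′ supplies the stage-duals hypothesis (at the same stage) -/

omit [IsDomain A] [IsNoetherianRing A] [CharZero K] [IsFractionRing A K] [QuasiCompact P.hom] [QuasiSeparated P.hom]
  [LocallyOfFinitePresentation P.hom] [IsSeparated P.hom]
  [∀ s : Idx (nonZeroDivisors A), IsLocallyNoetherian (P ⊗ (baseDiagram (nonZeroDivisors A)).obj s).left]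
  [IsLocallyNoetherian (P ⊗ specOver A K).left] [IsReduced (P ⊗ specOver A K).left] in
/-- **P-2′ ⇒ the stage-duals hypothesis** (`s := t`, `σ := 𝟙`; ★ `dualPairOf`). [cite: GortzWedhorn2023, Cor. 27.212 (pp. 685–686)] [cite: FaltingsChai1990, Ch. I §1 Thm. 1.9] -/
theorem stageDuals_of_dualAbelianSchemeExists (hdual : dualAbelianSchemeExists) {Z : Scheme.{0}} (A₁ : AbelianSchemeOver Z)
    (f : ∀ t : Idx (nonZeroDivisors A), Z ⟶ (P ⊗ (baseDiagram (nonZeroDivisors A)).obj t).left) :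
    ∀ (t : Idx (nonZeroDivisors A)) (𝒜ₜ : AbelianSchemeOver (P ⊗ (baseDiagram (nonZeroDivisors A)).obj t).left)
      (G : A₁.X.left ⟶ 𝒜ₜ.X.left), A₁.IsBaseChangeVia 𝒜ₜ (f t) G →
      ∃ (s : Idx (nonZeroDivisors A)) (σ : s ⟶ t), Nonempty (𝒜ₜ.baseChange (stageOver (nonZeroDivisors A) P σ).hom).DualPair :=
  fun t _ _ _ => ⟨t, 𝟙 t, ⟨dualPairOf hdual _⟩⟩

end Head

end AbelianSchemeOver

end Literature.AlgebraicGeometry.AbelianSchemes
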